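import Summits.MatrixMultiplication.OmegaCensus.STPPSmallPatternKernelSearch122

/-!
# ω-census, `(1,2,2)^4` is infeasible in `ℤ/5 × ℤ/5` — kernel search, part

HONEST FRAMING (pub-omega census; verbatim): lottery ticket; floor = certified bounds/negative ranges.
Census STRUCTURE bookkeeping of the STPP track (seat pub-omega-stpp-3, gen 23; STRUCTURE row B5, the threshold column
`T2(H) = max {k : (1,2,2)^k ⊆ H}`, lower side), not progress on `ω`: small patterns in small groups bound no exponent.

Representative chunks of `STPP122Neg.search2 (prodGC 5 (zcode 5)) 4` (`decide +kernel`, ≈ 107 s predicted);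
assembled in `STPPSmallPatternNone122K4P5x5.lean`.

References: H. Cohn, R. Kleinberg, B. Szegedy, C. Umans, FOCS 2005 (arXiv:math/0511460), Def. 5.1.
-/

set_option Elab.async false  -- several kernel pieces: elaborate sequentially (memory)

namespace Summit.MatrixMultiplication.OmegaCensus

namespace STPP122Neg

open STPP211Neg

/-- Chunked kernel search, `ℤ/5 × ℤ/5`, `k = 4`, chunks `(y, x1)` = [(1, 4194303)] (≈ 40 s predicted). -/
theorem P5_5k4v.s4 : search2x (prodGC 5 (zcode 5)) 4 [(1, 4194303)] = true := by
  decide +kernel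

/-- Chunked kernel search, `ℤ/5 × ℤ/5`, `k = 4`, chunks `(y, x1)` = [(6, 33554304)] (≈ 67 s predicted). -/
theorem P5_5k4v.s5 : search2x (prodGC 5 (zcode 5)) 4 [(6, 33554304)] = true := by
  decide +kernel

end STPP122Neg

end Summit.MatrixMultiplication.OmegaCensus
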